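import Literature.Computability.QuantumComplexity.ExactHalfQueryAlgorithmCore
import Literature.Computability.QuantumComplexity.ExactThresholdQueryComplexity
import HarnessLib

/-!
# `Q_E(EXACT_k^{2k}) = k`: the exact `k`-query algorithm of Ambainis–Iraids–Smotrovs (2013), Thm. 1

Topic `Computability/QuantumComplexity`. A. Ambainis, J. Iraids, J. Smotrovs, *Exact quantum query
complexity of EXACT and THRESHOLD*, TQC 2013 [AmbainisIraidsSmotrovs2013], §3 (held text
`paper:arxiv-1302.1235`, p. 5 L6–47; the proof is quoted and mapped declaration by declaration in
`ExactHalfQueryAlgorithmCore.lean`):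

> **Theorem 1.** `Q_E(EXACT_k^{2k}) ≤ k`. […] Note that we can delay the measurements by using `|i,j⟩`
> as a starting state for the recursive call of the algorithm.

This file assembles the program in the tree's model `QQueryAlg (2k)` [BealsEtAl2001, §2] and proves
Theorem 1 as printed, together with the equality `Q_E(EXACT_k^{2k}) = k` whose floor is [AIS13, Prop. 2]
(`max{k, 2k − k} ≤ Q_E`, typed as `ExactThreshold.le_quantumQueryComplexity_zero_exactWeight`):

* `G0` — the printed `U_1` (a Householder reflection `QProg.householder` preparing
  `(1/√(2k)) Σ_i |i⟩ ⊗ |−⟩ ⊗ |live, ∅⟩`, `c0`, `c0_eq_phiC`);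
* `roundGate r` — the printed `U_2` of the `r`-th call followed by the deferred measurement and the next
  call's `U_1`: `IsoGate.invoGateU (Dset k r) (wvec r) (wvec_isAdmissible r)`;
* `halfProg k = [G0, (O_x, U_0), …, (O_x, U_{k−1})]`, `numQueries_halfProg : = k`, `halfAlg k : QQueryAlg (2k)`
  accepting the live states with a full history (`acceptSet`);
* the invariant `runTok_rounds`: after `n ≤ k` rounds the state is `live x n + (parked)`, where
  `live x n = Σ_{g valid} β_n(g) · ψ_g ⊗ |−⟩` ("the resulting quantum state", round by round:
  `roundGate_query_live`, from `roundGate_mulVec_psiX` and the re-indexing `sum_validSet_offDiag_free`)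
  and parked vectors (`DeadLike`) are fixed by later rounds (`DeadLike.gate_mulVec`) and vanish on
  balanced inputs (`deadLike_deadNew`, from `sum_xhat_free_eq_zero`);
* exactness `halfAlg_acceptProb : acceptProb = [ |x| = k ]` — on balanced inputs nothing is parked and the
  whole unit mass sits on accepted states (`live_k_supp`, `QProg.sum_norm_sq_runTok`); otherwise no full
  history survives (`live_k_eq_zero`, from `hw_eq_of_beta_ne_zero`) and parked states are rejected;
* **`quantumQueryComplexity_exactHalf_le`** (`Q_ε([ |x| = k ]) ≤ k` on `Fin (2k)`, `0 ≤ ε`; Thm. 1) and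
  **`quantumQueryComplexity_zero_exactHalf`** (`Q_E([ |x| = k ]) = k`; Thm. 1 with Prop. 2).

Everything is proved; no fact, instance, notation or axiom is introduced. `k = 0` (no variables) is
covered by the model's convention `quantumQueryComplexity = 0` on `Fin 0`.

* [AmbainisIraidsSmotrovs2013] A. Ambainis, J. Iraids, J. Smotrovs, *Exact quantum query complexity of
  EXACT and THRESHOLD*, Proc. TQC 2013 (LIPIcs 22) 263–269; arXiv:1302.1235 — §3, Thm. 1 (p. 5 L6–47),
  Prop. 2 (p. 5 L68–75).
* [BealsEtAl2001] R. Beals, H. Buhrman, R. Cleve, M. Mosca, R. de Wolf, *Quantum lower bounds by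
  polynomials*, J. ACM 48(4) (2001) 778–797 — §2 (the query model, phase queries).
-/

noncomputable section

open Finset Matrix
open Literature.Computability.Cryptography
open Literature.Computability.QuantumComplexity.QProg
open Literature.Computability.QuantumComplexity.ExactThreshold (le_quantumQueryComplexity_zero_exactWeight)

namespace Literature.Computability.QuantumComplexity.ExactHalf

variable {k : ℕ}

section Alg

variable [NeZero k]

/-! ### The target qubit in `|−⟩` and the initial state -/

/-- The amplitudes of `|−⟩ = (|0⟩ − |1⟩)/√2` on the target qubit. [cite: BealsEtAl2001, §2] -/
def tgt (b : Bool) : ℝ := if b = true then -(1 / √2) else 1 / √2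

omit [NeZero k] in
/-- `|−⟩` is a unit vector. [cite: BealsEtAl2001, §2] -/
theorem tgt_sq_add : tgt false ^ 2 + tgt true ^ 2 = 1 := by
  simp only [tgt, Bool.false_eq_true, if_false, if_true, neg_sq, div_pow, one_pow, Real.sq_sqrt zero_le_two]
  norm_num

omit [NeZero k] in
/-- `O_x` on `|i⟩|−⟩` is the phase `x̂_i`: `tgt (b ⊕ x_i) = x̂_i · tgt b`. [cite: BealsEtAl2001, §2] -/
theorem tgt_xor (x : Fin (2 * k) → Bool) (i : Fin (2 * k)) (b : Bool) :
    ((tgt (b ^^ x i) : ℝ) : ℂ) = xhat x i * tgt b := by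
  unfold tgt xhat
  cases b <;> cases x i <;> push_cast <;> simp

/-- The two-slice state `ψ_g ⊗ |−⟩ = Σ_b tgt b · ψ_{g,b}`. [cite: AmbainisIraidsSmotrovs2013, §3] -/
def phiC (g : Hist k) : S k → ℂ := ∑ b : Bool, (tgt b : ℂ) • psiC g b

/-- Its phased form after a query. [cite: AmbainisIraidsSmotrovs2013, §3] -/
def phiX (x : Fin (2 * k) → Bool) (g : Hist k) : S k → ℂ := ∑ b : Bool, (tgt b : ℂ) • psiX x g b

/-- **The query acts on `ψ_g ⊗ |−⟩` by the phases `x̂_l`.** [cite: BealsEtAl2001, §2] -/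
theorem queryOracle_mulVec_phiC (x : Fin (2 * k) → Bool) (g : Hist k) :
    queryOracle x *ᵥ phiC g = phiX x g := by
  funext s
  obtain ⟨l, b', ws⟩ := s
  rw [queryOracle_mulVec_apply]
  simp only [phiC, phiX, Finset.sum_apply, Pi.smul_apply, smul_eq_mul, Fintype.sum_bool, psiX, psiC, psiR]
  by_cases hws : ws = (false, g)
  · cases b' <;> cases hx : x l <;> simp [tgt, xhat, hx, hws]
  · cases b' <;> cases hx : x l <;> simp [hws]

/-- The starting basis state `|i0⟩|0⟩|live, ∅⟩`. [cite: AmbainisIraidsSmotrovs2013, §3] -/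
def startS (k : ℕ) [NeZero k] : S k := (i0 k, false, (false, emptyHist k))

/-- The real amplitudes of the prepared state `(1/√(2k)) Σ_i |i⟩ ⊗ |−⟩ ⊗ |live, ∅⟩`.
[cite: AmbainisIraidsSmotrovs2013, §3 ("The algorithm … consisting of basis states … |2k⟩")] -/
def c0 (s : S k) : ℝ := tgt s.2.1 * psiR (emptyHist k) s.2.1 s

omit [NeZero k] in
/-- Slices, two-dimensional form. [folklore] -/
private theorem sum_slice₂ {M : Type*} [AddCommMonoid M] (ws : WS k) (G : Fin (2 * k) → Bool → M) :
    ∑ s : S k, (if s.2.2 = ws then G s.1 s.2.1 else 0) = ∑ l, ∑ b, G l b := by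
  rw [Fintype.sum_prod_type]
  refine Finset.sum_congr rfl fun l _ => ?_
  rw [Fintype.sum_prod_type]
  refine Finset.sum_congr rfl fun b _ => ?_
  rw [Finset.sum_ite_eq' univ ws]
  simp

/-- The prepared amplitudes form a unit vector. [cite: AmbainisIraidsSmotrovs2013, §3] -/
theorem sum_c0_sq : ∑ s : S k, c0 s ^ 2 = 1 := by
  have : ∀ s : S k, c0 s ^ 2 = if s.2.2 = (false, emptyHist k) then
      tgt s.2.1 ^ 2 * campl (emptyHist k) s.1 ^ 2 else 0 := fun s => by
    unfold c0 psiR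
    by_cases h : s.2.2 = (false, emptyHist k)
    · rw [if_pos ⟨rfl, h⟩, if_pos h]; ring
    · rw [if_neg (fun hh => h hh.2), if_neg h]; ring
  simp_rw [this]
  rw [sum_slice₂ (false, emptyHist k) (fun l b => tgt b ^ 2 * campl (emptyHist k) l ^ 2)]
  simp_rw [Fintype.sum_bool, ← add_mul]
  rw [add_comm, tgt_sq_add]
  simp [sum_campl_sq]

/-- The preparation gate `G₀`: a Householder reflection taking the start state to the prepared state.
[cite: AmbainisIraidsSmotrovs2013, §3] -/
def G0 (k : ℕ) [NeZero k] : Matrix.unitaryGroup (S k) ℂ :=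
  ⟨householder c0 (startS k), householder_mem_unitaryGroup _ _⟩

/-- `G₀ |start⟩ =` the prepared state. [cite: AmbainisIraidsSmotrovs2013, §3 (proof of Thm. 1)] -/
theorem G0_mulVec_start :
    (G0 k : Matrix (S k) (S k) ℂ) *ᵥ Pi.single (startS k) 1 = fun s => (c0 s : ℂ) :=
  householder_mulVec_single sum_c0_sq _

/-- The prepared state is `ψ_∅ ⊗ |−⟩`. [cite: AmbainisIraidsSmotrovs2013, §3] -/
theorem c0_eq_phiC : (fun s => (c0 s : ℂ)) = phiC (emptyHist k) := by
  funext s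
  simp only [phiC, c0, Finset.sum_apply, Pi.smul_apply, smul_eq_mul, Fintype.sum_bool, psiC]
  push_cast
  obtain ⟨l, b, ws⟩ := s
  cases b
  · simp [psiR]
  · simp [psiR]

/-! ### The round gates and the program -/

/-- The round gate `U_r` (the printed `U_{2m}` + deferred measurement + next preparation), as a unitary.
[cite: AmbainisIraidsSmotrovs2013, §3 (proof of Thm. 1)] -/
def roundGate (r : Fin k) : Matrix.unitaryGroup (S k) ℂ :=
  IsoGate.invoGateU (Dset k r) (wvec r) (wvec_isAdmissible r)

/-- The round gate by a natural index (identity past `k`). [folklore] -/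
def roundGateN (k : ℕ) [NeZero k] (n : ℕ) : Matrix.unitaryGroup (S k) ℂ :=
  if h : n < k then roundGate ⟨n, h⟩ else 1

/-- The first `n` rounds: `(query, U_0), …, (query, U_{n−1})`. [cite: AmbainisIraidsSmotrovs2013, §3] -/
def rounds (k : ℕ) [NeZero k] : ℕ → List (QTok (2 * k) (WS k))
  | 0 => []
  | n + 1 => rounds k n ++ [QTok.query, QTok.gate (roundGateN k n)]

/-- **The program**: prepare, then `k` rounds; `k` queries. [cite: AmbainisIraidsSmotrovs2013, Thm. 1] -/
def halfProg (k : ℕ) [NeZero k] : List (QTok (2 * k) (WS k)) := QTok.gate (G0 k) :: rounds k k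

/-- `n` rounds make `n` queries. [cite: AmbainisIraidsSmotrovs2013, §3 (proof of Thm. 1)] -/
theorem numQueries_rounds : ∀ n, numQueries (rounds k n) = n
  | 0 => rfl
  | n + 1 => by rw [rounds, numQueries_append, numQueries_rounds n]; rfl

/-- **`k` queries.** [cite: AmbainisIraidsSmotrovs2013, Thm. 1] -/
theorem numQueries_halfProg : numQueries (halfProg k) = k := by
  rw [halfProg, numQueries, numQueries_rounds]

/-- Accept iff the workspace is live with a full history (all `k` pairs observed mixed).
[cite: AmbainisIraidsSmotrovs2013, §3] -/
def acceptSet (k : ℕ) : Set (S k) := {s | s.2.2.1 = false ∧ free s.2.2.2 = ∅}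

/-- The algorithm in the model `QQueryAlg (2k)`. [cite: AmbainisIraidsSmotrovs2013, Thm. 1] -/
def halfAlg (k : ℕ) [NeZero k] : QQueryAlg (2 * k) := toAlg (halfProg k) (startS k) (acceptSet k)

/-- The algorithm makes `k` queries. [cite: AmbainisIraidsSmotrovs2013, Thm. 1] -/
theorem halfAlg_queries : (halfAlg k).queries = k := by
  rw [halfAlg, toAlg_queries, numQueries_halfProg]

/-! ### The live part of the state and the parked part -/

/-- The live part after `n` rounds: `Σ_{g valid} β(g) · ψ_g ⊗ |−⟩`. [cite: AmbainisIraidsSmotrovs2013, §3] -/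
def live (x : Fin (2 * k) → Bool) (n : ℕ) : S k → ℂ := ∑ g ∈ validSet k n, beta x n g • phiC g

omit [NeZero k] in
/-- The only valid `0`-history is the empty one. [cite: AmbainisIraidsSmotrovs2013, §3 (proof of Thm. 1)] -/
theorem validSet_zero : validSet k 0 = {emptyHist k} := by
  ext g
  rw [mem_validSet, Finset.mem_singleton]
  constructor
  · intro hv
    funext l
    cases hl : g l with
    | none => rfl
    | some r => exact absurd (hv.1 l r hl) (Nat.not_lt_zero _)
  · rintro rfl; exact valid_emptyHist

/-- Before the first round the live part is the prepared state. [cite: AmbainisIraidsSmotrovs2013, §3 (proof of Thm. 1)] -/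
theorem live_zero (x : Fin (2 * k) → Bool) : live x 0 = phiC (emptyHist k) := by
  rw [live, validSet_zero, Finset.sum_singleton, beta, one_smul]

/-- A parked vector before round `n`: supported on parked states with a history of an earlier level,
and identically zero on balanced inputs. [cite: AmbainisIraidsSmotrovs2013, §3] -/
structure DeadLike (x : Fin (2 * k) → Bool) (n : ℕ) (v : S k → ℂ) : Prop where
  supp : ∀ s, v s ≠ 0 → s.2.2.1 = true ∧ ∃ t < n, Valid t s.2.2.2
  zero : Grover.hw x = k → v = 0

omit [NeZero k] in
/-- The zero vector is parked. [cite: AmbainisIraidsSmotrovs2013, §3 (proof of Thm. 1)] -/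
theorem deadLike_zero (x : Fin (2 * k) → Bool) (n : ℕ) : DeadLike x n 0 :=
  ⟨fun _ hs => absurd rfl hs, fun _ => rfl⟩

omit [NeZero k] in
/-- Parked vectors form a subspace. [cite: AmbainisIraidsSmotrovs2013, §3 (proof of Thm. 1)] -/
theorem DeadLike.add {x : Fin (2 * k) → Bool} {n : ℕ} {v v' : S k → ℂ} (hv : DeadLike x n v)
    (hv' : DeadLike x n v') : DeadLike x n (v + v') := by
  refine ⟨fun s hs => ?_, fun hx => by rw [hv.zero hx, hv'.zero hx, add_zero]⟩
  by_cases h1 : v s = 0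
  · rw [Pi.add_apply, h1, zero_add] at hs; exact hv'.supp s hs
  · exact hv.supp s h1

omit [NeZero k] in
/-- Parked before round `n` is parked before any later round. [cite: AmbainisIraidsSmotrovs2013, §3 (proof of Thm. 1)] -/
theorem DeadLike.mono {x : Fin (2 * k) → Bool} {n n' : ℕ} (hn : n ≤ n') {v : S k → ℂ} (hv : DeadLike x n v) :
    DeadLike x n' v :=
  ⟨fun s hs => by obtain ⟨h1, t, ht, h2⟩ := hv.supp s hs; exact ⟨h1, t, by omega, h2⟩, hv.zero⟩

omit [NeZero k] in
/-- A query keeps parked vectors parked. [cite: AmbainisIraidsSmotrovs2013, §3] -/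
theorem DeadLike.query {x : Fin (2 * k) → Bool} {n : ℕ} {v : S k → ℂ} (hv : DeadLike x n v) :
    DeadLike x n (queryOracle x *ᵥ v) := by
  refine ⟨fun s hs => ?_, fun hx => by rw [hv.zero hx, mulVec_zero]⟩
  rw [queryOracle_mulVec_apply] at hs
  obtain ⟨h1, h2⟩ := hv.supp (s.1, (s.2.1 ^^ x s.1), s.2.2) hs
  exact ⟨h1, h2⟩

/-- **A round gate fixes parked vectors** (they are off `D_r` and orthogonal to every `w(d)`).
[cite: AmbainisIraidsSmotrovs2013, §3] -/
theorem DeadLike.gate_mulVec {x : Fin (2 * k) → Bool} (r : Fin k) {v : S k → ℂ} (hv : DeadLike x r.val v) :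
    (roundGate r : Matrix (S k) (S k) ℂ) *ᵥ v = v := by
  rw [roundGate, IsoGate.invoGateU_val]
  refine IsoGate.invoGate_mulVec_of_orthogonal v (fun d hd => ?_) (fun d hd => ?_)
  · by_contra hne
    have h1 := (hv.supp d hne).1
    rw [(mem_Dset.1 hd).1] at h1
    exact Bool.false_ne_true h1
  · obtain ⟨i, b, st, h⟩ := d
    obtain ⟨hst, hvh, -⟩ := mem_Dset.1 hd
    simp only at hst; subst hst
    rw [star_wvec, wvec_eq, smul_dotProduct, add_dotProduct, single_dotProduct, one_mul, sum_dotProduct]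
    have h1 : v (deadIdx b h) = 0 := by
      by_contra hne
      obtain ⟨-, t, ht, hvt⟩ := hv.supp _ hne
      have hr := r.isLt
      have := valid_level_eq hvh hvt (le_of_lt hr) (by omega)
      omega
    rw [h1, zero_add, Finset.sum_eq_zero, smul_zero]
    intro j _
    rw [smul_dotProduct, smul_eq_mul, dotProduct]
    refine mul_eq_zero_of_right _ (Finset.sum_eq_zero fun s _ => ?_)
    by_cases hs : v s = 0
    · rw [hs, mul_zero]
    · have := (hv.supp s hs).1
      rw [psiC, psiR_of_status this, Complex.ofReal_zero, zero_mul]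

/-- The newly parked part produced in round `r`:
`Σ_g β(g) Σ_b tgt b · (cw(g)² Σ_{l free} x̂_l) · |i0, b, parked, g⟩`. [cite: AmbainisIraidsSmotrovs2013, §3] -/
def deadNew (x : Fin (2 * k) → Bool) (r : Fin k) : S k → ℂ :=
  ∑ g ∈ validSet k r.val, beta x r.val g • ∑ b : Bool, (tgt b : ℂ) •
    ((((cw g : ℂ) ^ 2) * ∑ l ∈ free g, xhat x l) • (Pi.single (deadIdx b g) (1 : ℂ) : S k → ℂ))

/-- The newly parked part is parked, and vanishes on balanced inputs (`Σ_{free} x̂_l = 0`).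
[cite: AmbainisIraidsSmotrovs2013, §3 ("the amplitude of |0⟩ … is (1/2k) Σ x̂_i")] -/
theorem deadLike_deadNew (x : Fin (2 * k) → Bool) (r : Fin k) : DeadLike x (r.val + 1) (deadNew x r) := by
  refine ⟨fun s hs => ?_, fun hx => ?_⟩
  · by_contra hc
    apply hs
    rw [deadNew, Finset.sum_apply]
    refine Finset.sum_eq_zero fun g hg => ?_
    rw [Pi.smul_apply, Finset.sum_apply, Finset.sum_eq_zero, smul_zero]
    intro b _
    rw [Pi.smul_apply, Pi.smul_apply, Pi.single_eq_of_ne, smul_zero, smul_zero]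
    rintro rfl
    exact hc ⟨rfl, r.val, Nat.lt_succ_self _, mem_validSet.1 hg⟩
  · rw [deadNew]
    refine Finset.sum_eq_zero fun g hg => ?_
    have hv := mem_validSet.1 hg
    by_cases hb : beta x r.val g = 0
    · rw [hb, zero_smul]
    · rw [sum_xhat_free_eq_zero hv hb (le_of_lt r.isLt) hx]
      simp

omit [NeZero k] in
/-- The amplitude recursion at a round index. [cite: AmbainisIraidsSmotrovs2013, §3] -/
theorem beta_succ (x : Fin (2 * k) → Bool) (r : Fin k) (g : Hist k) :
    beta x (r.val + 1) g = beta x r.val (eraseRound g r) * pairSum x g r / (2 * ((k : ℂ) - r.val)) := by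
  rw [beta, dif_pos r.isLt]

/-! ### One round -/

/-- **The round gate on a phased slice state**: the parked component and the children.
[cite: AmbainisIraidsSmotrovs2013, §3 (proof of Thm. 1, "the algorithm … on this state gives the final state")] -/
theorem roundGate_mulVec_psiX (x : Fin (2 * k) → Bool) (r : Fin k) {g : Hist k} (hv : Valid r.val g) (b : Bool) :
    (roundGate r : Matrix (S k) (S k) ℂ) *ᵥ psiX x g b =
      (((cw g : ℂ) ^ 2) * ∑ l ∈ free g, xhat x l) • (Pi.single (deadIdx b g) (1 : ℂ) : S k → ℂ) +
        ((cw g : ℂ) ^ 2) • ∑ p ∈ (free g).offDiag,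
          (xhat x p.1 * pairSign p.1 p.2) • psiC (addPair g r p.1 p.2) b := by
  have hg : free g ≠ ∅ := by
    intro h0
    have := card_free_add r.val hv (le_of_lt r.isLt)
    rw [h0, Finset.card_empty] at this
    have := r.isLt; omega
  rw [psiX_eq_sum hg, mulVec_sum]
  have hcol : ∀ l ∈ free g, (roundGate r : Matrix (S k) (S k) ℂ) *ᵥ
      ((xhat x l * (cw g : ℂ)) • (Pi.single (l, b, (false, g)) (1 : ℂ) : S k → ℂ)) =
      (xhat x l * (cw g : ℂ) * cw g) • (Pi.single (deadIdx b g) (1 : ℂ) : S k → ℂ) +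
        ∑ j ∈ (free g).erase l, ((cw g : ℂ) ^ 2 * (xhat x l * pairSign l j)) • psiC (addPair g r l j) b := by
    intro l hl
    rw [mulVec_smul, roundGate, IsoGate.invoGateU_val,
      IsoGate.invoGate_mulVec_single (wvec_isAdmissible r) (mem_Dset.2 ⟨rfl, hv, mem_free.1 hl⟩),
      wvec_eq, smul_smul, smul_add, Finset.smul_sum]
    congr 1
    refine Finset.sum_congr rfl fun j _ => ?_
    rw [smul_smul]
    congr 1
    ring
  rw [Finset.sum_congr rfl hcol, Finset.sum_add_distrib, ← Finset.sum_smul, Finset.smul_sum,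
    sum_offDiag_eq_sum_erase]
  congr 1
  · congr 1
    rw [Finset.mul_sum]
    refine Finset.sum_congr rfl fun l _ => ?_
    ring
  · refine Finset.sum_congr rfl fun l _ => Finset.sum_congr rfl fun j _ => ?_
    rw [smul_smul]

/-- The query on the live part. [cite: AmbainisIraidsSmotrovs2013, §3] -/
theorem queryOracle_mulVec_live (x : Fin (2 * k) → Bool) (n : ℕ) :
    queryOracle x *ᵥ live x n = ∑ g ∈ validSet k n, beta x n g • phiX x g := by
  rw [live, mulVec_sum]
  refine Finset.sum_congr rfl fun g _ => ?_
  rw [mulVec_smul, queryOracle_mulVec_phiC]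

omit [NeZero k] in
/-- `cw(g)² = 1/(2(k − r))` on valid `r`-histories. [cite: AmbainisIraidsSmotrovs2013, §3] -/
theorem cw_sq_eq (r : Fin k) {g : Hist k} (hv : Valid r.val g) :
    ((cw g : ℂ) ^ 2) = 1 / (2 * ((k : ℂ) - r.val)) := by
  have hc := card_free_add r.val hv (le_of_lt r.isLt)
  have hg : free g ≠ ∅ := by
    intro h0; rw [h0, Finset.card_empty] at hc; have := r.isLt; omega
  have h1 := cw_sq_mul_card hg
  have hcard : ((free g).card : ℝ) = 2 * ((k : ℝ) - r.val) := by
    have : (free g).card = 2 * k - 2 * r.val := by omega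
    rw [this, Nat.cast_sub (by have := r.isLt; omega)]
    push_cast; ring
  rw [hcard] at h1
  have hne : (2 * ((k : ℝ) - r.val)) ≠ 0 := by
    have := r.isLt
    have : (r.val : ℝ) < k := by exact_mod_cast this
    nlinarith
  have h2 : cw g ^ 2 = 1 / (2 * ((k : ℝ) - r.val)) := (eq_div_iff hne).2 h1
  have h3 : ((cw g : ℂ) ^ 2) = ((cw g ^ 2 : ℝ) : ℂ) := by push_cast; ring
  rw [h3, h2]
  push_cast
  ring

/-- **One round on the live part**: `U_r O_x (live_r) = live_{r+1} + (newly parked)`.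
[cite: AmbainisIraidsSmotrovs2013, §3 (proof of Thm. 1)] -/
theorem roundGate_query_live (x : Fin (2 * k) → Bool) (r : Fin k) :
    (roundGate r : Matrix (S k) (S k) ℂ) *ᵥ (queryOracle x *ᵥ live x r.val) =
      live x (r.val + 1) + deadNew x r := by
  rw [queryOracle_mulVec_live, mulVec_sum]
  -- expand each `g`-term with the round lemma
  have hterm : ∀ g ∈ validSet k r.val, (roundGate r : Matrix (S k) (S k) ℂ) *ᵥ (beta x r.val g • phiX x g) =
      beta x r.val g • ∑ b : Bool, (tgt b : ℂ) •
        ((((cw g : ℂ) ^ 2) * ∑ l ∈ free g, xhat x l) • (Pi.single (deadIdx b g) (1 : ℂ) : S k → ℂ)) +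
      ∑ b : Bool, ∑ p ∈ (free g).offDiag,
        (beta x r.val (eraseRound (addPair g r p.1 p.2) r) * (tgt b : ℂ) * (1 / (2 * ((k : ℂ) - r.val))) *
          (xhat x p.1 * pairSign p.1 p.2)) • psiC (addPair g r p.1 p.2) b := by
    intro g hg
    have hv := mem_validSet.1 hg
    rw [mulVec_smul, phiX, mulVec_sum, Finset.sum_congr rfl fun b _ => by
      rw [mulVec_smul, roundGate_mulVec_psiX x r hv b]]
    simp only [smul_add, Finset.sum_add_distrib, Finset.smul_sum, smul_smul]
    congr 1
    refine Finset.sum_congr rfl fun b _ => Finset.sum_congr rfl fun p hp => ?_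
    obtain ⟨hp1, hp2, -⟩ := Finset.mem_offDiag.1 hp
    rw [eraseRound_addPair hv (r := r) le_rfl (mem_free.1 hp1) (mem_free.1 hp2), cw_sq_eq r hv]
    congr 1
    ring
  rw [Finset.sum_congr rfl hterm, Finset.sum_add_distrib, add_comm]
  congr 1
  -- the children: write `live_{r+1}` as a `(b, g')` double sum, commute, re-index, fold `β_{r+1}`
  have hlive : live x (r.val + 1) = ∑ b : Bool, ∑ g' ∈ validSet k (r.val + 1),
      (beta x (r.val + 1) g' * (tgt b : ℂ)) • psiC g' b := by
    rw [live]
    have hg : ∀ g' ∈ validSet k (r.val + 1), beta x (r.val + 1) g' • phiC g' =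
        ∑ b : Bool, (beta x (r.val + 1) g' * (tgt b : ℂ)) • psiC g' b := fun g' _ => by
      rw [phiC, Finset.smul_sum]
      exact Finset.sum_congr rfl fun b _ => by rw [smul_smul]
    rw [Finset.sum_congr rfl hg, Finset.sum_comm]
  rw [hlive, Finset.sum_comm]
  refine Finset.sum_congr rfl fun b _ => ?_
  calc ∑ g ∈ validSet k r.val, ∑ p ∈ (free g).offDiag,
        (beta x r.val (eraseRound (addPair g r p.1 p.2) r) * (tgt b : ℂ) * (1 / (2 * ((k : ℂ) - r.val))) *
          (xhat x p.1 * pairSign p.1 p.2)) • psiC (addPair g r p.1 p.2) b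
      = ∑ g' ∈ validSet k (r.val + 1), ∑ p ∈ (labelSet g' r).offDiag,
        (beta x r.val (eraseRound g' r) * (tgt b : ℂ) * (1 / (2 * ((k : ℂ) - r.val))) *
          (xhat x p.1 * pairSign p.1 p.2)) • psiC g' b :=
        sum_validSet_offDiag_free r.isLt (fun g' p => (beta x r.val (eraseRound g' r) * (tgt b : ℂ) *
          (1 / (2 * ((k : ℂ) - r.val))) * (xhat x p.1 * pairSign p.1 p.2)) • psiC g' b)
    _ = ∑ g' ∈ validSet k (r.val + 1), (beta x (r.val + 1) g' * (tgt b : ℂ)) • psiC g' b := by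
        refine Finset.sum_congr rfl fun g' _ => ?_
        rw [← Finset.sum_smul, ← Finset.mul_sum, beta_succ, pairSum]
        congr 1
        ring

/-! ### The invariant -/

/-- **The state after `n ≤ k` rounds** is the live part plus a parked vector.
[cite: AmbainisIraidsSmotrovs2013, §3 (proof of Thm. 1)] -/
theorem runTok_rounds (x : Fin (2 * k) → Bool) :
    ∀ n, n ≤ k → ∃ v, DeadLike x n v ∧
      runTok x (QTok.gate (G0 k) :: rounds k n) (Pi.single (startS k) 1) = live x n + v
  | 0, _ => ⟨0, deadLike_zero x 0, by
      rw [rounds, runTok_cons, runTok_nil, QTok.mat, G0_mulVec_start, c0_eq_phiC, live_zero, add_zero]⟩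
  | n + 1, hn => by
    obtain ⟨v, hv, hrun⟩ := runTok_rounds x n (by omega)
    have hnk : n < k := by omega
    refine ⟨deadNew x ⟨n, hnk⟩ + queryOracle x *ᵥ v,
      (deadLike_deadNew x ⟨n, hnk⟩).add (hv.query.mono (Nat.le_succ n)), ?_⟩
    rw [rounds, ← List.cons_append, runTok_append, hrun]
    simp only [runTok_cons, runTok_nil, QTok.mat, roundGateN, dif_pos hnk]
    have h2 : (roundGate ⟨n, hnk⟩ : Matrix (S k) (S k) ℂ) *ᵥ (queryOracle x *ᵥ live x n) =
        live x (n + 1) + deadNew x ⟨n, hnk⟩ := roundGate_query_live x ⟨n, hnk⟩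
    rw [mulVec_add, mulVec_add, DeadLike.gate_mulVec ⟨n, hnk⟩ hv.query, h2, add_assoc]

/-! ### Exactness -/

/-- On unbalanced inputs no full history survives: `live_k = 0`. [cite: AmbainisIraidsSmotrovs2013, §3] -/
theorem live_k_eq_zero {x : Fin (2 * k) → Bool} (hx : Grover.hw x ≠ k) : live x k = 0 := by
  rw [live]
  refine Finset.sum_eq_zero fun g hg => ?_
  by_cases hb : beta x k g = 0
  · rw [hb, zero_smul]
  · exact absurd (hw_eq_of_beta_ne_zero (mem_validSet.1 hg) hb) hx

/-- The full-history live part sits inside the accepting set. [cite: AmbainisIraidsSmotrovs2013, §3] -/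
theorem live_k_supp {x : Fin (2 * k) → Bool} {s : S k} (hs : live x k s ≠ 0) : s ∈ acceptSet k := by
  rw [live, Finset.sum_apply] at hs
  obtain ⟨g, hg, hgs⟩ := Finset.exists_ne_zero_of_sum_ne_zero hs
  rw [Pi.smul_apply, phiC, Finset.sum_apply] at hgs
  obtain ⟨b, -, hbs⟩ := Finset.exists_ne_zero_of_sum_ne_zero (right_ne_zero_of_smul hgs)
  rw [Pi.smul_apply] at hbs
  obtain ⟨-, h2⟩ := psiC_ne_zero (right_ne_zero_of_smul hbs)
  have hv := mem_validSet.1 hg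
  have h0 : free g = ∅ := by
    have := card_free_add k hv le_rfl
    exact Finset.card_eq_zero.1 (by omega)
  show s.2.2.1 = false ∧ free s.2.2.2 = ∅
  rw [h2]
  exact ⟨rfl, h0⟩

omit [NeZero k] in
/-- The weight of a set on a vector supported inside it is the full `ℓ²` mass. [folklore] -/
private theorem wt_eq_sum_of_supp {A : Set (S k)} {u : S k → ℂ} (hu : ∀ s, u s ≠ 0 → s ∈ A) :
    wt A u = ∑ s, ‖u s‖ ^ 2 := by
  classical
  unfold wt
  exact Finset.sum_filter_of_ne fun s _ hs => hu s (by intro h0; apply hs; rw [h0]; simp)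

omit [NeZero k] in
/-- The weight of a set on a vector supported outside it is `0`. [folklore] -/
private theorem wt_eq_zero_of_supp {A : Set (S k)} {u : S k → ℂ} (hu : ∀ s, u s ≠ 0 → s ∉ A) : wt A u = 0 := by
  classical
  unfold wt
  refine Finset.sum_eq_zero fun s hs => ?_
  rw [Finset.mem_filter] at hs
  by_cases h0 : u s = 0
  · rw [h0]; simp
  · exact absurd hs.2 (hu s h0)

/-- **The program computes `EXACT_k^{2k}` exactly**: acceptance probability `[ |x| = k ]`.
[cite: AmbainisIraidsSmotrovs2013, Thm. 1] -/
theorem halfAlg_acceptProb (x : Fin (2 * k) → Bool) :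
    (halfAlg k).acceptProb x = if Grover.hw x = k then 1 else 0 := by
  rw [halfAlg, toAlg_acceptProb, halfProg]
  obtain ⟨v, hv, hrun⟩ := runTok_rounds x k le_rfl
  rw [hrun]
  by_cases hx : Grover.hw x = k
  · rw [if_pos hx, hv.zero hx, add_zero, wt_eq_sum_of_supp fun s hs => live_k_supp hs]
    have h := sum_norm_sq_runTok x (QTok.gate (G0 k) :: rounds k k) (Pi.single (startS k) 1)
    rw [hrun, hv.zero hx, add_zero] at h
    rw [h, Finset.sum_eq_single (startS k)]
    · simp
    · intro s _ hs; rw [Pi.single_eq_of_ne hs]; simp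
    · intro h1; exact absurd (Finset.mem_univ _) h1
  · rw [if_neg hx, live_k_eq_zero hx, zero_add]
    refine wt_eq_zero_of_supp fun s hs hA => ?_
    have h1 := (hv.supp s hs).1
    rw [hA.1] at h1
    exact Bool.false_ne_true h1

/-- The program computes `EXACT_k^{2k}` with error `0` on every input. [cite: AmbainisIraidsSmotrovs2013, Thm. 1] -/
theorem halfAlg_computesWithError :
    (halfAlg k).ComputesWithError 0 Set.univ fun x => decide (Grover.hw x = k) := by
  intro x _
  rw [halfAlg_acceptProb]
  constructor
  · intro h
    rw [decide_eq_true_eq] at h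
    rw [if_pos h]; norm_num
  · intro h
    have h' : ¬ Grover.hw x = k := by simpa using h
    rw [if_neg h']

end Alg

/-! ### Theorem 1 -/

/-- **Ceiling [AIS13, Thm. 1]: `Q_ε(EXACT_k^{2k}) ≤ k`** for every `0 ≤ ε` (the `k`-query exact algorithm).
[cite: AmbainisIraidsSmotrovs2013, Thm. 1] -/
theorem quantumQueryComplexity_exactHalf_le {ε : ℝ} (hε : 0 ≤ ε) :
    quantumQueryComplexity ε (fun x : Fin (2 * k) → Bool => decide (Grover.hw x = k)) ≤ k := by
  rcases Nat.eq_zero_or_pos k with rfl | hk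
  · exact (quantumQueryComplexity_le_holds ε hε _).trans (by norm_num)
  · haveI : NeZero k := NeZero.of_pos hk
    change quantumQueryComplexityOn ε Set.univ _ ≤ _
    calc quantumQueryComplexityOn ε Set.univ (fun x : Fin (2 * k) → Bool => decide (Grover.hw x = k))
        ≤ (halfAlg k).queries :=
          Nat.sInf_le ⟨halfAlg k, rfl, halfAlg_computesWithError.mono hε (Set.subset_univ _)⟩
      _ = k := halfAlg_queries

/-- **Ambainis–Iraids–Smotrovs, Thm. 1 with Prop. 2: `Q_E(EXACT_k^{2k}) = k`** — the floor
`max{k, 2k − k} ≤ Q_E` is `ExactThreshold.le_quantumQueryComplexity_zero_exactWeight` (typed, Q11).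
[cite: AmbainisIraidsSmotrovs2013, Thm. 1] -/
theorem quantumQueryComplexity_zero_exactHalf :
    quantumQueryComplexity 0 (fun x : Fin (2 * k) → Bool => decide (Grover.hw x = k)) = k :=
  le_antisymm (quantumQueryComplexity_exactHalf_le le_rfl) (by
    have h := le_quantumQueryComplexity_zero_exactWeight (N := 2 * k) (t := k) (by omega)
    rwa [show 2 * k - k = k by omega, max_self] at h)

/-! ### Checks -/

/-- `k = 1`: one query decides `x₀ ⊕ x₁` (`EXACT_1^2 = XOR`, Deutsch). [cite: AmbainisIraidsSmotrovs2013, Thm. 1] -/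
example : quantumQueryComplexity 0 (fun x : Fin (2 * 1) → Bool => decide (Grover.hw x = 1)) = 1 :=
  quantumQueryComplexity_zero_exactHalf

/-- `k = 2`: `Q_E(EXACT_2^4) = 2` (classically `D = 4`). [cite: AmbainisIraidsSmotrovs2013, Thm. 1] -/
example : quantumQueryComplexity 0 (fun x : Fin (2 * 2) → Bool => decide (Grover.hw x = 2)) = 2 :=
  quantumQueryComplexity_zero_exactHalf

/-- The program makes exactly `k` queries (here `k = 3`). [cite: AmbainisIraidsSmotrovs2013, Thm. 1] -/
example : numQueries (halfProg 3) = 3 := numQueries_halfProg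

/-- Exactness: the acceptance probability is `{0,1}`-valued at every input. [cite: AmbainisIraidsSmotrovs2013, Thm. 1] -/
example [NeZero k] (x : Fin (2 * k) → Bool) :
    (halfAlg k).acceptProb x = 0 ∨ (halfAlg k).acceptProb x = 1 := by
  rw [halfAlg_acceptProb]; split_ifs <;> simp

end Literature.Computability.QuantumComplexity.ExactHalf

end
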